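import Summits.QuantumFields.QCD.Theorems.QuarksAsStableActionStableActionBridgeChiralWindow

/-!
# The stability hypothesis bites along the bare-mass trajectories of a `QCDRegularisation`
(crux `QuarksAsStableAction.StableActionBridge`, item stmt-QuantumFields-9737, line `Sketch`;
registered stub `stability_along_trajectory` of the lead skeleton)

The route's stability crux `WilsonQuarkStability` (S) bounds the antiperiodic `r = 1` Wilson-quark
determinant `|det D_AP[U, m]| ≤ exp(K + c₂·S_good(U) + C·N_bad(U))·|det D_AP[𝟙, m]|` for bare masses
in a window `|m| ≤ ε` around the free critical point, uniformly in the torus side `L ≥ L₀` and in the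
`SU(3)` gauge field `U`.  The re-typed summit statement runs lattice QCD along the bare trajectories
`m_f(k) = m_crit(k) + a_k m_f / Z_m(k)` of a `QCDRegularisation` (`QCDRegularisation.scheme_mq`).

`stability_along_trajectory` — S BITES along those trajectories eventually in `k`, for every tuple of
renormalised masses `m` and every species renormalisation `(z, shift)`, provided the critical bare
mass tends to the free value (`m_crit(k) → 0`) and `a_k / Z_m(k) → 0`: by `eventually_abs_mq_le`
(the ChiralWindow file) the trajectories enter the window `|m_f(k)| ≤ ε` eventually, and there S
applies verbatim (the `let`-bound determinant `apDet` and plaquette deficit `dfc` of S and of the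
conclusion are syntactically identical).  Pure logic / filter bookkeeping; S is a HYPOTHESIS.
-/

open Filter MeasureTheory Literature.MathematicalPhysics.QuantumFieldTheory Literature.MathematicalPhysics.QuantumLattice
open Summit.QuantumFields.QCD.Theses.QuarksAsStableAction (WilsonQuarkStability)
open scoped Topology

namespace Summit.QuantumFields.QCD.Cruxes.StableActionBridge.Sketch

/-- **Stability bites along the bare trajectories, eventually.** Assume the stability bound S
(`WilsonQuarkStability`, with window `|m| ≤ ε`, plaquette threshold `δ`, constants `K, c₂, C` and
minimal side `L₀`).  If `m_crit(k) → 0` and `a_k / Z_m(k) → 0`, then with the SAME `δ, K, c₂, C, L₀`,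
for every mass tuple `m` and species renormalisations `z, shift`, eventually in `k`: for every side
`L ≥ L₀`, every flavour `f` and every `SU(3)` gauge field `U`, the antiperiodic Wilson determinant at
the bare mass `m_f(k) = m_crit(k) + a_k m_f / Z_m(k)` obeys the stability bound relative to the free
field.  Proof: `eventually_abs_mq_le` puts all `m_f(k)` in the window `|·| ≤ ε` eventually; apply S.
[folklore] -/
theorem stability_along_trajectory : WilsonQuarkStability → ∀ (Nf : ℕ) (reg : QCDRegularisation Nf), Tendsto reg.mcrit atTop (𝓝 0) → Tendsto (fun k => reg.a k / reg.Zm k) atTop (𝓝 0) → ∃ δ K c₂ C : ℝ, 0 < δ ∧ ∃ L₀ : ℕ, ∀ (m : Fin Nf → ℝ) (z shift : QCDField Nf → ℕ → ℝ), ∀ᶠ k in atTop, ∀ (L : ℕ) [NeZero L], L₀ ≤ L → let apDet : GaugeConfig 4 L (Matrix.specialUnitaryGroup (Fin 3) ℂ) → ℝ → ℂ := fun U m => fermionDet (wilsonDirac (unitaryFundamentalRep (Fin 3) ℂ) (fun e => if e.1 e.2 = -1 then -(⟨(U e).1, Matrix.specialUnitaryGroup_le_unitaryGroup (U e).2⟩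 : Matrix.unitaryGroup (Fin 3) ℂ) else ⟨(U e).1, Matrix.specialUnitaryGroup_le_unitaryGroup (U e).2⟩) m 1); let dfc : GaugeConfig 4 L (Matrix.specialUnitaryGroup (Fin 3) ℂ) → Plaquette 4 L → ℝ := fun U p => 3 - (fundamentalRep (Fin 3) (plaquetteHolonomy U p.1 p.2.1.1 p.2.1.2)).trace.re; ∀ (f : Fin Nf) (U : GaugeConfig 4 L (Matrix.specialUnitaryGroup (Fin 3) ℂ)), ‖apDet U ((reg.scheme m z shift).mq f k)‖ ≤ Real.exp (K + c₂ * (∑ p ∈ Finset.univ.filter (fun p => dfc U p < δ), dfc U p) + C * ((Finset.univ.filter (fun p => δ ≤ dfc U p)).card : ℝ)) * ‖apDet 1 ((reg.scheme m z shift).mq f k)‖ := by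
  intro hS Nf reg hcrit haZ
  obtain ⟨ε, δ, K, c₂, C, hε, hδ, L₀, h⟩ := hS
  refine ⟨δ, K, c₂, C, hδ, L₀, fun m z shift => ?_⟩
  -- the bare trajectories enter the window `|m_f(k)| ≤ ε` eventually (all flavours at once)
  have hwin : ∀ᶠ k in atTop, ∀ f, |(reg.scheme m z shift).mq f k| ≤ ε :=
    eventually_abs_mq_le Nf reg m z shift ε hε hcrit haZ
  filter_upwards [hwin] with k hk
  intro L _ hL apDet dfc f U
  -- S at side `L`, bare mass `m_f(k)` (in the window by `hk f`) and field `U`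
  exact h L hL ((reg.scheme m z shift).mq f k) (hk f) U

end Summit.QuantumFields.QCD.Cruxes.StableActionBridge.Sketch
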